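import Literature.Analysis.Complex.RiemannDomainWeakDbar
import Literature.Analysis.InnerProduct.AdjointRangeEstimate
import Mathlib.MeasureTheory.Function.L2Space
import Mathlib.Analysis.InnerProductSpace.LinearPMap
import HarnessLib

/-!
# Hörmander's `L²` set-up for `∂̄` on a Riemann domain: weighted spaces, `T`, `F`, and `T*`

Layer `Literature/Analysis/Complex`; continues `RiemannDomainWeakDbar.lean` (L. Hörmander, *An
Introduction to Complex Analysis in Several Variables* (1973), §4.1 p. 77–78 and §4.2 p. 82–83, on
a space `D` spread over `ℂ^ι`). With three continuous weights `φ₁, φ₂, φ₃` (`Weights`):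

* `volW φ = e^{-φ} d vol` — the measure of `L²(Ω, φ)` (p. 77: «the space of functions which are
  square integrable with respect to the measure `e^{-φ} dλ`»); finiteness on compacts, the density
  formula for integrals, and `L²(volW φ) ⊆ L¹_loc(vol)` (`locallyIntegrable_of_memLp_volW`);
* `Weights.H1 = L²(D, φ₁)`, `Weights.H2 = L²_{(0,1)}(D, φ₂)` (as `PiLp 2` of `ι` copies of `L²`),
  inner product formulas;
* **`T`** (`Weights.T : H1 →ₗ.[ℂ] H2`) — «the operator `∂̄` defines [a] linear, …, densely defined
  operator» (p. 78), defined from its GRAPH `{(u, g) | ∂̄ u = g weakly}` (`Weights.graphT`, a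
  functional linear relation by a.e. uniqueness of weak derivatives); `hasWeakDbar_T`, `T_eq`,
  test functions in the domain with `T w = ∂̄ w` (`T_testFn`), **density of the domain**
  (`dense_domT`, from the density of test functions in `L²`);
* **`F`** (`Weights.F`) — the closed subspace `{f | ∂̄ f = 0 weakly}` of `H2` (the null space `N_S`
  of `S`, p. 78), closed (`isClosed_F`) and containing the range of `T` (`T_mem_F`, «`R_T ⊂ N_S`»);
* **`T*` on test forms** (`testForm_mem_adjoint`, `adjoint_testForm`: p. 83 (4.2.4) in the form
  `T* f = -e^{φ₁-φ₂} ∑_j (∂_j f_j - f_j ∂_j φ₂)`), and the distributional identity satisfied by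
  every `f ∈ D_{T*}` (`hasWeakDelDiv_adjoint`: `∑_j ∂_j (e^{-φ₂} f_j) = -e^{-φ₁} T* f` weakly),
  which is what Friedrichs mollification consumes in the density Lemma 4.1.3.

Mathlib's `LinearPMap.adjoint` (`T†`) is the Hilbert-space adjoint; the tree's Lemma 4.1.1
(`Literature/Analysis/InnerProduct/AdjointRangeEstimate`) is phrased for it. Everything is proved;
definitions: `weight`, `volW`, `Weights` and its spaces/operators/test elements; no named facts.

## References

* L. Hörmander, *An Introduction to Complex Analysis in Several Variables*, 2nd ed. (1973), §4.1
  (p. 77–78), §4.2 (p. 82–83, (4.2.4)). [HormanderSCV1973]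

#harness_tags complex_analysis.several_variables, complex_analysis.l2_estimates, complex_geometry.riemann_existence
-/

noncomputable section

open scoped Manifold ContDiff Topology ComplexConjugate NNReal InnerProductSpace
open scoped LinearPMap
open Set Filter Function Complex MeasureTheory MeasureTheory.Measure

namespace Literature.Analysis.Complex

namespace RiemannDomain

universe u

variable {ι : Type} [Fintype ι] {D : RiemannDomain.{u} ι}

/-! ### Weighted Lebesgue measures `e^{-φ} d vol` -/

section WeightedMeasure

variable (D)

/-- The density `e^{-φ}` as a non-negative real function. [cite: HormanderSCV1973, §4.1 (p. 77)] -/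
def weight (φ : D → ℝ) (x : D) : ℝ≥0 := ⟨Real.exp (-φ x), (Real.exp_pos _).le⟩

/-- **The measure `e^{-φ} dλ` of the space `L²(Ω, φ)`** on the Riemann domain `D` (`dλ = vol`).
[cite: HormanderSCV1973, §4.1 (p. 77)] -/
def volW (φ : D → ℝ) : Measure D := D.vol.withDensity fun x ↦ (D.weight φ x : ENNReal)

variable {D}
variable {φ : D → ℝ}

/-- The density is `e^{-φ}`. [folklore] -/
@[simp] theorem coe_weight (φ : D → ℝ) (x : D) : (D.weight φ x : ℝ) = Real.exp (-φ x) := rfl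

/-- The density is positive. [folklore] -/
theorem weight_pos (φ : D → ℝ) (x : D) : 0 < D.weight φ x := by
  rw [← NNReal.coe_pos, coe_weight]; exact Real.exp_pos _

/-- The density never vanishes. [folklore] -/
theorem weight_ne_zero (φ : D → ℝ) (x : D) : (D.weight φ x : ENNReal) ≠ 0 := by
  simpa using (weight_pos φ x).ne'

/-- The density is continuous for `φ` continuous. [folklore] -/
theorem continuous_weight (hφ : Continuous φ) : Continuous (D.weight φ) := by
  refine continuous_induced_rng.2 ?_
  exact (Real.continuous_exp.comp hφ.neg)

/-- The density is measurable for `φ` continuous. [folklore] -/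
theorem measurable_weight (hφ : Continuous φ) : Measurable (D.weight φ) := (continuous_weight hφ).measurable

/-- The density is measurable as an `ℝ≥0∞`-valued function. [folklore] -/
theorem measurable_coe_weight (hφ : Continuous φ) : Measurable fun x ↦ (D.weight φ x : ENNReal) :=
  (measurable_weight hφ).coe_nnreal_ennreal

/-- **A.e. for `e^{-φ} d vol` is a.e. for `vol`.** [folklore] -/
theorem ae_volW_iff (hφ : Continuous φ) {p : D → Prop} : (∀ᵐ x ∂D.volW φ, p x) ↔ ∀ᵐ x ∂D.vol, p x := by
  rw [volW, ae_withDensity_iff (measurable_coe_weight hφ)]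
  exact ⟨fun h ↦ h.mono fun x hx ↦ hx (weight_ne_zero φ x), fun h ↦ h.mono fun x hx _ ↦ hx⟩

/-- A.e.-equalities transfer between `e^{-φ} d vol` and `vol`. [folklore] -/
theorem eventuallyEq_volW_iff (hφ : Continuous φ) {G' : Type*} {f g : D → G'} :
    f =ᵐ[D.volW φ] g ↔ f =ᵐ[D.vol] g := ae_volW_iff hφ

/-- `e^{-φ} d vol ≪ vol`. [folklore] -/
theorem volW_absolutelyContinuous (φ : D → ℝ) : D.volW φ ≪ D.vol := withDensity_absolutelyContinuous _ _

/-- `vol ≪ e^{-φ} d vol`. [folklore] -/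
theorem vol_absolutelyContinuous_volW (hφ : Continuous φ) : D.vol ≪ D.volW φ := by
  refine AbsolutelyContinuous.mk fun s _ hs0 ↦ ?_
  have : ∀ᵐ x ∂D.volW φ, x ∉ s := by
    rw [ae_iff]; simpa using hs0
  rw [ae_volW_iff hφ] at this
  simpa [ae_iff] using this

/-- **`e^{-φ} d vol` is finite on compact sets** (the density is bounded on compacts).
[cite: HormanderSCV1973, §4.1 (p. 77)] -/
theorem isFiniteMeasureOnCompacts_volW (hφ : Continuous φ) : IsFiniteMeasureOnCompacts (D.volW φ) := by
  refine ⟨fun K hK ↦ ?_⟩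
  obtain ⟨M, hM⟩ := hK.exists_bound_of_continuousOn (f := fun x ↦ (D.weight φ x : ℝ))
    ((NNReal.continuous_coe.comp (continuous_weight hφ)).continuousOn)
  have hM' : ∀ x ∈ K, (D.weight φ x : ENNReal) ≤ ENNReal.ofReal M := fun x hx ↦ by
    have := hM x hx
    rw [Real.norm_eq_abs, NNReal.abs_eq] at this
    rw [← ENNReal.ofReal_coe_nnreal]
    exact ENNReal.ofReal_le_ofReal this
  rw [volW, withDensity_apply _ hK.measurableSet]
  calc ∫⁻ x in K, (D.weight φ x : ENNReal) ∂D.vol ≤ ∫⁻ _ in K, ENNReal.ofReal M ∂D.vol :=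
        setLIntegral_mono measurable_const hM'
    _ = ENNReal.ofReal M * D.vol K := setLIntegral_const _ _
    _ < ⊤ := ENNReal.mul_lt_top ENNReal.ofReal_lt_top hK.measure_lt_top

/-- **Integrals against `e^{-φ} d vol`**: `∫ f e^{-φ} d vol`. [cite: HormanderSCV1973, §4.1 (p. 77)] -/
theorem integral_volW (hφ : Continuous φ) {G' : Type*} [NormedAddCommGroup G'] [NormedSpace ℝ G'] (f : D → G') :
    ∫ x, f x ∂D.volW φ = ∫ x, Real.exp (-φ x) • f x ∂D.vol := by
  rw [volW, integral_withDensity_eq_integral_smul (measurable_weight hφ)]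
  rfl

/-- Complex form: `∫ f d(e^{-φ} vol) = ∫ e^{-φ} f d vol`. [cite: HormanderSCV1973, §4.1 (p. 77)] -/
theorem integral_volW_mul (hφ : Continuous φ) (f : D → ℂ) :
    ∫ x, f x ∂D.volW φ = ∫ x, (Real.exp (-φ x) : ℂ) * f x ∂D.vol := by
  rw [integral_volW hφ]
  exact integral_congr_ae (ae_of_all _ fun x ↦ by simp only [real_smul])

/-- On a compact set, `vol ≤ e^{M} · e^{-φ} vol` with `M = max_K φ`. [folklore] -/
theorem vol_restrict_le_smul_volW (hφ : Continuous φ) {K : Set D} (hK : IsCompact K) :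
    ∃ c : ENNReal, c ≠ ⊤ ∧ D.vol.restrict K ≤ c • (D.volW φ).restrict K := by
  -- bound `φ ≤ M` on `K`
  obtain ⟨M, hM⟩ : ∃ M : ℝ, ∀ x ∈ K, φ x ≤ M := by
    rcases K.eq_empty_or_nonempty with rfl | hne
    · exact ⟨0, fun x hx ↦ hx.elim⟩
    · obtain ⟨x₀, -, hx₀⟩ := hK.exists_isMaxOn hne hφ.continuousOn
      exact ⟨φ x₀, fun x hx ↦ hx₀ hx⟩
  refine ⟨ENNReal.ofReal (Real.exp M), ENNReal.ofReal_ne_top, ?_⟩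
  have hKm : MeasurableSet K := hK.measurableSet
  rw [volW, restrict_withDensity hKm, ← withDensity_smul _ (measurable_coe_weight hφ)]
  conv_lhs => rw [← withDensity_one (μ := D.vol.restrict K)]
  refine withDensity_mono ?_
  rw [EventuallyLE, ae_restrict_iff' hKm]
  refine ae_of_all _ fun x hx ↦ ?_
  simp only [Pi.one_apply, Pi.smul_apply, smul_eq_mul]
  rw [← ENNReal.ofReal_coe_nnreal, coe_weight, ← ENNReal.ofReal_mul (Real.exp_pos _).le, ← Real.exp_add]
  rw [← ENNReal.ofReal_one]
  exact ENNReal.ofReal_le_ofReal (Real.one_le_exp (by linarith [hM x hx]))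

/-- **`L^p(e^{-φ} vol) ⊆ L¹_loc(vol)`** for `1 ≤ p`: on a compact set the weight is bounded below.
[cite: HormanderSCV1973, §4.1 (p. 77–78)] -/
theorem locallyIntegrable_of_memLp_volW (hφ : Continuous φ) {G' : Type*} [NormedAddCommGroup G']
    {p : ENNReal} (hp : 1 ≤ p) {f : D → G'} (hf : MemLp f p (D.volW φ)) : LocallyIntegrable f D.vol := by
  refine locallyIntegrable_iff.2 fun K hK ↦ ?_
  obtain ⟨c, hc, hle⟩ := vol_restrict_le_smul_volW hφ hK
  have h1 : MemLp f p ((D.volW φ).restrict K) := hf.restrict K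
  have h2 : MemLp f p (D.vol.restrict K) := h1.of_measure_le_smul hc hle
  haveI : IsFiniteMeasure (D.vol.restrict K) := ⟨by rw [Measure.restrict_apply_univ]; exact hK.measure_lt_top⟩
  exact h2.integrable hp

/-- In particular `L²(e^{-φ} vol) ⊆ L¹_loc(vol)`. [cite: HormanderSCV1973, §4.1 (p. 77–78)] -/
theorem locallyIntegrable_of_memLp_two_volW (hφ : Continuous φ) {G' : Type*} [NormedAddCommGroup G']
    {f : D → G'} (hf : MemLp f 2 (D.volW φ)) : LocallyIntegrable f D.vol :=
  locallyIntegrable_of_memLp_volW hφ one_le_two hf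

/-- A continuous compactly supported function times an `L²(e^{-φ} vol)` function, reweighted by
`e^{-φ}`, is `vol`-integrable: the pairing `∫ f w̄ e^{-φ} d vol` makes sense. [folklore] -/
theorem integrable_mul_mul_weight (hφ : Continuous φ) {f w : D → ℂ} (hf : MemLp f 2 (D.volW φ))
    (hw : Continuous w) (hwc : HasCompactSupport w) :
    Integrable (fun x ↦ f x * (w x * (Real.exp (-φ x) : ℂ))) D.vol :=
  (locallyIntegrable_of_memLp_two_volW hφ hf).integrable_smul_right_of_hasCompactSupport
    (hw.mul (continuous_ofReal.comp (Real.continuous_exp.comp hφ.neg))) (hwc.mul_right)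

end WeightedMeasure

/-! ### Three weights and the Hilbert spaces `H₁ = L²(D, φ₁)`, `H₂ = L²_{(0,1)}(D, φ₂)` -/

variable (D) in
/-- **Three continuous weights** `φ₁, φ₂, φ₃` on `D` (Hörmander p. 78: «`φ₁, φ₂, φ₃` are continuous
functions in `Ω`; further conditions will be imposed on them later on»).
[cite: HormanderSCV1973, §4.1 (p. 78)] -/
structure Weights where
  /-- the weight of `H₁ = L²(D, φ₁)` -/
  φ₁ : D → ℝ
  /-- the weight of `H₂ = L²_{(0,1)}(D, φ₂)` -/
  φ₂ : D → ℝ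
  /-- the weight of `H₃ = L²_{(0,2)}(D, φ₃)` -/
  φ₃ : D → ℝ
  continuous₁ : Continuous φ₁
  continuous₂ : Continuous φ₂
  continuous₃ : Continuous φ₃

namespace Weights

variable (W : Weights D)

/-- `e^{-φ₁} d vol`. [cite: HormanderSCV1973, §4.1 (p. 78)] -/
abbrev μ₁ : Measure D := D.volW W.φ₁
/-- `e^{-φ₂} d vol`. [cite: HormanderSCV1973, §4.1 (p. 78)] -/
abbrev μ₂ : Measure D := D.volW W.φ₂
/-- `e^{-φ₃} d vol`. [cite: HormanderSCV1973, §4.1 (p. 78)] -/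
abbrev μ₃ : Measure D := D.volW W.φ₃

/-- `e^{-φ₁} vol` is finite on compact sets. [folklore] -/
instance instIsFiniteMeasureOnCompacts₁ : IsFiniteMeasureOnCompacts W.μ₁ := isFiniteMeasureOnCompacts_volW W.continuous₁
/-- `e^{-φ₂} vol` is finite on compact sets. [folklore] -/
instance instIsFiniteMeasureOnCompacts₂ : IsFiniteMeasureOnCompacts W.μ₂ := isFiniteMeasureOnCompacts_volW W.continuous₂
/-- `e^{-φ₃} vol` is finite on compact sets. [folklore] -/
instance instIsFiniteMeasureOnCompacts₃ : IsFiniteMeasureOnCompacts W.μ₃ := isFiniteMeasureOnCompacts_volW W.continuous₃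

/-- **`H₁ = L²(D, φ₁)`.** [cite: HormanderSCV1973, §4.1 (p. 78)] -/
abbrev H1 : Type u := Lp ℂ 2 W.μ₁
/-- **`H₂ = L²_{(0,1)}(D, φ₂)`**, a `(0,1)`-form being the `ι`-tuple of its coefficients.
[cite: HormanderSCV1973, §4.1 (p. 78)] -/
abbrev H2 : Type u := PiLp 2 fun _ : ι ↦ Lp ℂ 2 W.μ₂
/-- **`H₃ = L²_{(0,2)}(D, φ₃)`**, indexed by ordered pairs (antisymmetric coefficients, each
unordered pair counted twice). [cite: HormanderSCV1973, §4.1 (p. 78)] -/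
abbrev H3 : Type u := PiLp 2 fun _ : ι × ι ↦ Lp ℂ 2 W.μ₃

/-! #### Inner products -/

/-- The inner product of `H₁`: `(u, v)_{φ₁} = ∫ ū v e^{-φ₁} d vol`. [cite: HormanderSCV1973, §4.1 (p. 77)] -/
theorem inner_H1 (u v : W.H1) : ⟪u, v⟫_ℂ = ∫ x, (Real.exp (-W.φ₁ x) : ℂ) * (conj (u x) * v x) ∂D.vol := by
  rw [L2.inner_def, integral_volW_mul W.continuous₁]
  exact integral_congr_ae (ae_of_all _ fun x ↦ by simp only [RCLike.inner_apply, mul_comm (v x)])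

/-- The inner product of `H₂`: `(f, g)_{φ₂} = ∑_j ∫ f̄_j g_j e^{-φ₂} d vol`. [cite: HormanderSCV1973, §4.1 (p. 77)] -/
theorem inner_H2 (f g : W.H2) : ⟪f, g⟫_ℂ = ∑ j, ∫ x, (Real.exp (-W.φ₂ x) : ℂ) * (conj (f j x) * g j x) ∂D.vol := by
  rw [PiLp.inner_apply]
  refine Finset.sum_congr rfl fun j _ ↦ ?_
  rw [L2.inner_def, integral_volW_mul W.continuous₂]
  exact integral_congr_ae (ae_of_all _ fun x ↦ by simp only [RCLike.inner_apply, mul_comm (g j x)])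

/-! #### Test functions and test forms as elements -/

variable {W}

/-- Test functions are in `H₁`. [folklore] -/
theorem memLp₁ (W : Weights D) {w : D → ℂ} (hw : IsTest w) : MemLp w 2 W.μ₁ := hw.memLp 2 W.μ₁

/-- Test functions are in `L²(D, φ₂)`. [folklore] -/
theorem memLp₂ (W : Weights D) {w : D → ℂ} (hw : IsTest w) : MemLp w 2 W.μ₂ := hw.memLp 2 W.μ₂

/-- Test functions are in `L²(D, φ₃)`. [folklore] -/
theorem memLp₃ (W : Weights D) {w : D → ℂ} (hw : IsTest w) : MemLp w 2 W.μ₃ := hw.memLp 2 W.μ₃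

/-- A test function as an element of `H₁`. [cite: HormanderSCV1973, §4.1 (p. 77)] -/
def testFn (W : Weights D) {w : D → ℂ} (hw : IsTest w) : W.H1 := (W.memLp₁ hw).toLp w

/-- The test function element is represented by the test function. [folklore] -/
theorem coeFn_testFn {w : D → ℂ} (hw : IsTest w) : (W.testFn hw : D → ℂ) =ᵐ[D.vol] w :=
  (eventuallyEq_volW_iff W.continuous₁).1 (MemLp.coeFn_toLp _)

/-- A test form (an `ι`-tuple of test functions) as an element of `H₂`.
[cite: HormanderSCV1973, §4.1 (p. 77)] -/
def testForm (W : Weights D) {f : ι → D → ℂ} (hf : ∀ j, IsTest (f j)) : W.H2 :=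
  WithLp.toLp 2 fun j ↦ (W.memLp₂ (hf j)).toLp (f j)

/-- Components of the test form element. [folklore] -/
theorem testForm_apply {f : ι → D → ℂ} (hf : ∀ j, IsTest (f j)) (j : ι) :
    W.testForm hf j = (W.memLp₂ (hf j)).toLp (f j) := rfl

/-- The components of the test form element are represented by the test functions. [folklore] -/
theorem coeFn_testForm {f : ι → D → ℂ} (hf : ∀ j, IsTest (f j)) (j : ι) :
    (W.testForm hf j : D → ℂ) =ᵐ[D.vol] f j := by
  rw [testForm_apply]
  exact (eventuallyEq_volW_iff W.continuous₂).1 (MemLp.coeFn_toLp _)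

/-- Elements of `H₁` are locally `vol`-integrable. [folklore] -/
theorem locallyIntegrable_H1 (u : W.H1) : LocallyIntegrable (u : D → ℂ) D.vol :=
  locallyIntegrable_of_memLp_two_volW W.continuous₁ (Lp.memLp u)

/-- Components of elements of `H₂` are locally `vol`-integrable. [folklore] -/
theorem locallyIntegrable_H2 (g : W.H2) (j : ι) : LocallyIntegrable (g j : D → ℂ) D.vol :=
  locallyIntegrable_of_memLp_two_volW W.continuous₂ (Lp.memLp (g j))

/-- Components of elements of `H₃` are locally `vol`-integrable. [folklore] -/
theorem locallyIntegrable_H3 (s : W.H3) (jk : ι × ι) : LocallyIntegrable (s jk : D → ℂ) D.vol :=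
  locallyIntegrable_of_memLp_two_volW W.continuous₃ (Lp.memLp (s jk))

/-! ### The operator `T` from its graph -/

section OperatorT

variable [DecidableEq ι]
variable (W)

/-- **The graph of `T`**: pairs `(u, g) ∈ H₁ × H₂` with `∂̄ u = g` weakly.
[cite: HormanderSCV1973, §4.1 (p. 78)] -/
def graphT : Submodule ℂ (W.H1 × W.H2) where
  carrier := {p | HasWeakDbar D (p.1 : D → ℂ) (fun x j ↦ (p.2 j : D → ℂ) x)}
  zero_mem' := by
    refine hasWeakDbar_zero.congr_ae ?_ fun j ↦ ?_
    · exact ((eventuallyEq_volW_iff W.continuous₁).1 (Lp.coeFn_zero ℂ 2 W.μ₁)).symm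
    · have : ((0 : W.H2) j : D → ℂ) =ᵐ[D.vol] 0 :=
        (eventuallyEq_volW_iff W.continuous₂).1 (by rw [PiLp.zero_apply]; exact Lp.coeFn_zero ℂ 2 W.μ₂)
      exact this.symm
  add_mem' {p q} hp hq := by
    refine (hp.add hq).congr_ae ?_ fun j ↦ ?_
    · exact ((eventuallyEq_volW_iff W.continuous₁).1 (Lp.coeFn_add p.1 q.1)).symm
    · have : ((p + q).2 j : D → ℂ) =ᵐ[D.vol] fun x ↦ (p.2 j : D → ℂ) x + (q.2 j : D → ℂ) x := by
        rw [Prod.snd_add, PiLp.add_apply]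
        exact (eventuallyEq_volW_iff W.continuous₂).1 (Lp.coeFn_add _ _)
      exact this.symm
  smul_mem' c p hp := by
    refine (hp.const_mul c).congr_ae ?_ fun j ↦ ?_
    · have : ((c • p).1 : D → ℂ) =ᵐ[D.vol] fun x ↦ c * (p.1 : D → ℂ) x := by
        rw [Prod.smul_fst]
        exact (eventuallyEq_volW_iff W.continuous₁).1 (Lp.coeFn_smul c p.1)
      exact this.symm
    · have : ((c • p).2 j : D → ℂ) =ᵐ[D.vol] fun x ↦ c * (p.2 j : D → ℂ) x := by
        rw [Prod.smul_snd, PiLp.smul_apply]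
        exact (eventuallyEq_volW_iff W.continuous₂).1 (Lp.coeFn_smul c (p.2 j))
      exact this.symm

variable {W}

/-- Membership in the graph of `T`. [folklore] -/
theorem mem_graphT_iff {p : W.H1 × W.H2} :
    p ∈ W.graphT ↔ HasWeakDbar D (p.1 : D → ℂ) (fun x j ↦ (p.2 j : D → ℂ) x) := Iff.rfl

omit [DecidableEq ι] in
/-- An element of `H₂` whose components vanish `vol`-a.e. is zero. [folklore] -/
theorem H2_eq_zero_of_ae {g : W.H2} (hg : ∀ j, (g j : D → ℂ) =ᵐ[D.vol] 0) : g = 0 := by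
  ext j : 1
  rw [PiLp.zero_apply]
  exact Lp.eq_zero_iff_ae_eq_zero.2 ((eventuallyEq_volW_iff W.continuous₂).2 (hg j))

/-- **The graph of `T` is functional**: `(0, g) ∈ graph T ⇒ g = 0` (a.e. uniqueness of weak `∂̄`).
[cite: HormanderSCV1973, §4.1 (p. 78)] -/
theorem graphT_functional : ∀ p ∈ W.graphT, p.1 = 0 → p.2 = 0 := by
  rintro ⟨u, g⟩ hp rfl
  have h0 : HasWeakDbar D ((0 : W.H1) : D → ℂ) (fun _ _ ↦ 0) :=
    hasWeakDbar_zero.congr_ae ((eventuallyEq_volW_iff W.continuous₁).1 (Lp.coeFn_zero ℂ 2 W.μ₁)).symm fun _ ↦ EventuallyEq.rfl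
  exact H2_eq_zero_of_ae fun j ↦ (mem_graphT_iff.1 hp).ae_eq h0 j

variable (W) in
/-- **The operator `T = ∂̄ : H₁ → H₂`** (maximal, i.e. weak, realisation: Hörmander p. 78), the
linear partial map whose graph is `graphT`. [cite: HormanderSCV1973, §4.1 (p. 78)] -/
def T : W.H1 →ₗ.[ℂ] W.H2 := W.graphT.toLinearPMap

/-- The graph of `T` is `graphT`. [folklore] -/
theorem graph_T : W.T.graph = W.graphT := Submodule.toLinearPMap_graph_eq _ graphT_functional

/-- **`T u = ∂̄ u` weakly** for `u ∈ D_T`. [cite: HormanderSCV1973, §4.1 (p. 78)] -/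
theorem hasWeakDbar_T (u : W.T.domain) : HasWeakDbar D ((u : W.H1) : D → ℂ) (fun x j ↦ (W.T u j : D → ℂ) x) := by
  have h : ((u : W.H1), W.T u) ∈ W.T.graph := LinearPMap.mem_graph W.T u
  rw [graph_T] at h
  exact mem_graphT_iff.1 h

/-- Membership in `D_T`: `u ∈ D_T` iff `∂̄ u = g` weakly for some `g ∈ H₂`. [cite: HormanderSCV1973, §4.1 (p. 78)] -/
theorem mem_domT_iff {u : W.H1} : u ∈ W.T.domain ↔ ∃ g : W.H2, HasWeakDbar D (u : D → ℂ) (fun x j ↦ (g j : D → ℂ) x) := by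
  constructor
  · intro hu
    exact ⟨W.T ⟨u, hu⟩, hasWeakDbar_T ⟨u, hu⟩⟩
  · rintro ⟨g, hg⟩
    have : (u, g) ∈ W.T.graph := by rw [graph_T]; exact hg
    exact W.T.mem_domain_of_mem_graph this

/-- **`T` is determined by the weak relation**: if `∂̄ u = g` weakly with `g ∈ H₂` then `u ∈ D_T` and
`T u = g`. [cite: HormanderSCV1973, §4.1 (p. 78)] -/
theorem T_eq {u : W.H1} {g : W.H2} (hg : HasWeakDbar D (u : D → ℂ) (fun x j ↦ (g j : D → ℂ) x)) :
    ∃ hu : u ∈ W.T.domain, W.T ⟨u, hu⟩ = g := by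
  have hmem : (u, g) ∈ W.T.graph := by rw [graph_T]; exact hg
  refine ⟨W.T.mem_domain_of_mem_graph hmem, ?_⟩
  obtain ⟨y, h1, h2⟩ := W.T.mem_graph_iff.1 hmem
  have hy : y = ⟨u, W.T.mem_domain_of_mem_graph hmem⟩ := Subtype.ext (by simpa using h1)
  rw [← hy]
  simpa using h2

/-- **Test functions lie in `D_T` with `T w = ∂̄ w`.** [cite: HormanderSCV1973, §4.1 (p. 78)] -/
theorem T_testFn {w : D → ℂ} (hw : IsTest w) :
    ∃ hu : W.testFn hw ∈ W.T.domain, W.T ⟨W.testFn hw, hu⟩ = W.testForm fun j ↦ hw.dbar (Pi.single j 1) := by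
  refine T_eq ((hasWeakDbar_of_contMDiff hw.contMDiff).congr_ae (coeFn_testFn hw).symm fun j ↦ ?_)
  exact (coeFn_testForm (fun j ↦ hw.dbar (Pi.single j 1)) j).symm

/-- Test functions lie in `D_T`. [cite: HormanderSCV1973, §4.1 (p. 78)] -/
theorem testFn_mem_domT {w : D → ℂ} (hw : IsTest w) : W.testFn hw ∈ W.T.domain := (T_testFn hw).1

/-- **`D_T` is dense in `H₁`** (it contains the test functions, which are dense in `L²(D, φ₁)`,
`RiemannDomainTestFunctions.exists_isTest_eLpNorm_sub_le`). [cite: HormanderSCV1973, §4.1 (p. 77–78)] -/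
theorem dense_domT : Dense (W.T.domain : Set W.H1) := by
  intro u
  rw [Metric.mem_closure_iff]
  intro ε hε
  have hε2 : ENNReal.ofReal (ε / 2) ≠ 0 := by simpa using hε
  obtain ⟨w, hw, hwε⟩ := exists_isTest_eLpNorm_sub_le (μ := W.μ₁) one_le_two ENNReal.ofNat_ne_top (Lp.memLp u) hε2
  refine ⟨W.testFn hw, testFn_mem_domT hw, ?_⟩
  rw [Lp.dist_def]
  have hcongr : eLpNorm ((u : D → ℂ) - (W.testFn hw : D → ℂ)) 2 W.μ₁ = eLpNorm ((u : D → ℂ) - w) 2 W.μ₁ :=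
    eLpNorm_congr_ae ((EventuallyEq.rfl).sub (MemLp.coeFn_toLp _))
  rw [hcongr]
  calc (eLpNorm ((u : D → ℂ) - w) 2 W.μ₁).toReal ≤ (ENNReal.ofReal (ε / 2)).toReal :=
        ENNReal.toReal_mono ENNReal.ofReal_ne_top hwε
    _ = ε / 2 := ENNReal.toReal_ofReal (by linarith)
    _ < ε := by linarith

end OperatorT

/-! ### The closed subspace `F = {∂̄ f = 0}` -/

section SubspaceF

variable [DecidableEq ι]
variable (W)

/-- **`F = N_S`**: the forms `f ∈ H₂` with `∂̄ f = 0` weakly. [cite: HormanderSCV1973, §4.1 (p. 78)] -/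
def F : Submodule ℂ W.H2 where
  carrier := {f | HasWeakDbarForm D (fun x j ↦ (f j : D → ℂ) x) (fun _ _ _ ↦ 0)}
  zero_mem' := by
    refine hasWeakDbarForm_zero.congr_ae (fun j ↦ ?_) fun _ _ ↦ EventuallyEq.rfl
    exact ((eventuallyEq_volW_iff W.continuous₂).1 (by rw [PiLp.zero_apply]; exact Lp.coeFn_zero ℂ 2 W.μ₂)).symm
  add_mem' {f g} hf hg := by
    refine (hf.add hg).congr_ae (fun j ↦ ?_) fun _ _ ↦ ae_of_all _ fun _ ↦ add_zero _
    have : ((f + g) j : D → ℂ) =ᵐ[D.vol] fun x ↦ (f j : D → ℂ) x + (g j : D → ℂ) x := by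
      rw [PiLp.add_apply]
      exact (eventuallyEq_volW_iff W.continuous₂).1 (Lp.coeFn_add _ _)
    exact this.symm
  smul_mem' c f hf := by
    refine (hf.const_mul c).congr_ae (fun j ↦ ?_) fun _ _ ↦ ae_of_all _ fun _ ↦ mul_zero _
    have : ((c • f) j : D → ℂ) =ᵐ[D.vol] fun x ↦ c * (f j : D → ℂ) x := by
      rw [PiLp.smul_apply]
      exact (eventuallyEq_volW_iff W.continuous₂).1 (Lp.coeFn_smul c (f j))
    exact this.symm

variable {W}

/-- Membership in `F`. [folklore] -/
theorem mem_F_iff {f : W.H2} : f ∈ W.F ↔ HasWeakDbarForm D (fun x j ↦ (f j : D → ℂ) x) (fun _ _ _ ↦ 0) := Iff.rfl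

/-- **`R_T ⊆ F`** («the range `R_T` of `T` lies in the null space `N_S` of `S`», p. 78).
[cite: HormanderSCV1973, §4.1 (p. 78)] -/
theorem T_mem_F (u : W.T.domain) : W.T u ∈ W.F := (hasWeakDbar_T u).hasWeakDbarForm_zero

omit [DecidableEq ι] in
/-- **Pairings with test functions are inner products**: for `g ∈ L²(e^{-φ} vol)` and `w`
continuous with compact support, `∫ g w d vol = (v, g)_{φ}` with `v = w̄ e^{φ} ∈ L²(e^{-φ} vol)`.
[folklore] -/
theorem exists_integral_mul_eq_inner {φ : D → ℝ} (hφ : Continuous φ) {w : D → ℂ} (hw : Continuous w)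
    (hwc : HasCompactSupport w) :
    ∃ v : Lp ℂ 2 (D.volW φ), ∀ g : Lp ℂ 2 (D.volW φ), ∫ x, (g : D → ℂ) x * w x ∂D.vol = ⟪v, g⟫_ℂ := by
  haveI : IsFiniteMeasureOnCompacts (D.volW φ) := isFiniteMeasureOnCompacts_volW hφ
  set v : D → ℂ := fun x ↦ conj (w x) * (Real.exp (φ x) : ℂ) with hv
  have hvc : Continuous v := (continuous_conj.comp hw).mul (continuous_ofReal.comp (Real.continuous_exp.comp hφ))
  have hvs : HasCompactSupport v := hwc.comp_left (g := conj) (map_zero _) |>.mul_right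
  have hvm : MemLp v 2 (D.volW φ) := hvc.memLp_of_hasCompactSupport hvs
  refine ⟨hvm.toLp v, fun g ↦ ?_⟩
  rw [L2.inner_def, integral_volW_mul hφ]
  have hae : (hvm.toLp v : D → ℂ) =ᵐ[D.vol] v := (eventuallyEq_volW_iff hφ).1 (MemLp.coeFn_toLp _)
  refine integral_congr_ae ?_
  filter_upwards [hae] with x hx
  rw [RCLike.inner_apply, hx, hv]
  simp only [map_mul, conj_conj, conj_ofReal]
  have h1 : (Real.exp (-φ x) : ℂ) * (Real.exp (φ x) : ℂ) = 1 := by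
    rw [← ofReal_mul, Real.exp_neg, inv_mul_cancel₀ (Real.exp_pos _).ne', ofReal_one]
  linear_combination (-(w x * (g : D → ℂ) x)) * h1

omit [DecidableEq ι] in
/-- **Pairings with test functions are continuous on `L²(e^{-φ} vol)`.** [folklore] -/
theorem continuous_integral_mul {φ : D → ℝ} (hφ : Continuous φ) {w : D → ℂ} (hw : Continuous w)
    (hwc : HasCompactSupport w) :
    Continuous fun g : Lp ℂ 2 (D.volW φ) ↦ ∫ x, (g : D → ℂ) x * w x ∂D.vol := by
  obtain ⟨v, hv⟩ := exists_integral_mul_eq_inner hφ hw hwc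
  simp_rw [hv]
  exact continuous_const.inner continuous_id

/-- Membership in `F` through separately integrated terms. [folklore] -/
theorem mem_F_iff' {f : W.H2} : f ∈ W.F ↔ ∀ (j k : ι) (w : D → ℂ), IsTest w →
    ∫ x, (f k : D → ℂ) x * dbar (Pi.single j 1) w x ∂D.vol - ∫ x, (f j : D → ℂ) x * dbar (Pi.single k 1) w x ∂D.vol = 0 := by
  rw [mem_F_iff]
  have hi : ∀ (i i' : ι) {w : D → ℂ}, IsTest w → Integrable (fun x ↦ (f i : D → ℂ) x * dbar (Pi.single i' 1) w x) D.vol :=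
    fun i i' w hw ↦ integrable_mul_isTest (locallyIntegrable_H2 f i) (hw.dbar _)
  constructor
  · intro h j k w hw
    have := h.integral_eq j k w hw
    rw [integral_sub (hi k j hw) (hi j k hw)] at this
    simpa using this
  · intro h
    exact { locallyIntegrable := locallyIntegrable_H2 f
            locallyIntegrable_deriv := fun _ _ ↦ locallyIntegrable_zero
            integral_eq := fun j k w hw ↦ by
              rw [integral_sub (hi k j hw) (hi j k hw), h j k w hw]
              simp }

/-- **`F` is closed in `H₂`** (each defining pairing is continuous). [cite: HormanderSCV1973, §4.1 (p. 78)] -/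
theorem isClosed_F : IsClosed (W.F : Set W.H2) := by
  have hset : (W.F : Set W.H2) = ⋂ (j : ι) (k : ι) (w : {w : D → ℂ // IsTest w}),
      {f : W.H2 | ∫ x, (f k : D → ℂ) x * dbar (Pi.single j 1) w.1 x ∂D.vol -
        ∫ x, (f j : D → ℂ) x * dbar (Pi.single k 1) w.1 x ∂D.vol = 0} := by
    ext f
    simp only [SetLike.mem_coe, mem_iInter, mem_setOf_eq, Subtype.forall]
    exact mem_F_iff'
  rw [hset]
  refine isClosed_iInter fun j ↦ isClosed_iInter fun k ↦ isClosed_iInter fun w ↦ ?_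
  have hcj : Continuous fun f : W.H2 ↦ ∫ x, (f k : D → ℂ) x * dbar (Pi.single j 1) w.1 x ∂D.vol :=
    (continuous_integral_mul W.continuous₂ (w.2.dbar _).continuous (w.2.dbar _).hasCompactSupport).comp
      ((continuous_apply k).comp (PiLp.continuous_ofLp 2 _))
  have hck : Continuous fun f : W.H2 ↦ ∫ x, (f j : D → ℂ) x * dbar (Pi.single k 1) w.1 x ∂D.vol :=
    (continuous_integral_mul W.continuous₂ (w.2.dbar _).continuous (w.2.dbar _).hasCompactSupport).comp
      ((continuous_apply j).comp (PiLp.continuous_ofLp 2 _))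
  exact isClosed_eq (hcj.sub hck) continuous_const

end SubspaceF

/-! ### The adjoint `T*` -/

section Adjoint

/-- Flat `∂_v` of `e^{-φ}` for `φ` smooth: `∂_v e^{-φ} = -(∂_v φ) e^{-φ}`. [folklore] -/
theorem del_exp_neg {φ : D → ℝ} (hφ : ContMDiff 𝓘(ℝ, ι → ℂ) 𝓘(ℝ, ℝ) ∞ φ) (v : ι → ℂ) (x : D) :
    del v (fun y ↦ (Real.exp (-φ y) : ℂ)) x = -del v (fun y ↦ (φ y : ℂ)) x * (Real.exp (-φ x) : ℂ) := by
  rw [del_eq (D.coe_chart x) (D.mem_chart_source x), del_eq (D.coe_chart x) (D.mem_chart_source x)]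
  have hd : DifferentiableAt ℝ (φ ∘ (D.chart x).symm) (D.proj x) :=
    (contMDiffAt_iff_contDiffAt.1 (hφ x)).differentiableAt (by simp)
  have := delAlong_ofReal_exp_neg hd v
  simp only [comp_apply, D.chart_symm_proj] at this ⊢
  exact this

/-- Flat `∂̄_v` of `e^{-φ}` for `φ` smooth: `∂̄_v e^{-φ} = -(∂̄_v φ) e^{-φ}`. [folklore] -/
theorem dbar_exp_neg {φ : D → ℝ} (hφ : ContMDiff 𝓘(ℝ, ι → ℂ) 𝓘(ℝ, ℝ) ∞ φ) (v : ι → ℂ) (x : D) :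
    dbar v (fun y ↦ (Real.exp (-φ y) : ℂ)) x = -dbar v (fun y ↦ (φ y : ℂ)) x * (Real.exp (-φ x) : ℂ) := by
  rw [dbar_eq (D.coe_chart x) (D.mem_chart_source x), dbar_eq (D.coe_chart x) (D.mem_chart_source x)]
  have hd : DifferentiableAt ℝ (φ ∘ (D.chart x).symm) (D.proj x) :=
    (contMDiffAt_iff_contDiffAt.1 (hφ x)).differentiableAt (by simp)
  have := dbarAlong_ofReal_exp_neg hd v
  simp only [comp_apply, D.chart_symm_proj] at this ⊢
  exact this

/-- `e^{-φ}` is `C^∞` (as a complex function) for `φ` smooth. [folklore] -/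
theorem contMDiff_exp_neg {φ : D → ℝ} (hφ : ContMDiff 𝓘(ℝ, ι → ℂ) 𝓘(ℝ, ℝ) ∞ φ) :
    ContMDiff 𝓘(ℝ, ι → ℂ) 𝓘(ℝ, ℂ) ∞ fun y ↦ (Real.exp (-φ y) : ℂ) :=
  contMDiff_ofReal (contMDiff_exp hφ.neg)

/-- `conj (∂̄_v u) = ∂_v ū`. [folklore] -/
theorem conj_dbar (u : D → ℂ) (x : D) (v : ι → ℂ) : conj (dbar v u x) = del v (fun y ↦ conj (u y)) x := by
  have h := dbar_conj (fun y ↦ conj (u y)) x v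
  simp only [conj_conj] at h
  rw [h, conj_conj]

/-- `∂̄_v φ = conj (∂_v φ)` for a REAL function `φ` (read in `ℂ`). [folklore] -/
theorem dbar_ofReal_eq_conj_del (φ : D → ℝ) (v : ι → ℂ) (x : D) :
    dbar v (fun y ↦ (φ y : ℂ)) x = conj (del v (fun y ↦ (φ y : ℂ)) x) := by
  have h := dbar_conj (fun y ↦ (φ y : ℂ)) x v
  simpa only [conj_ofReal] using h

variable [DecidableEq ι] {W : Weights D}

/-- **The formal adjoint `ϑ_φ f`** of a smooth form (Hörmander (4.2.4) unwound):
`ϑ f = -e^{φ₁ - φ₂} ∑_j (∂_j f_j - f_j ∂_j φ₂)`. [cite: HormanderSCV1973, §4.2 (4.2.4)] -/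
def formalAdjoint (W : Weights D) (f : ι → D → ℂ) (x : D) : ℂ :=
  -(Real.exp (W.φ₁ x - W.φ₂ x) : ℂ) * ∑ j, (del (Pi.single j 1) (f j) x - f j x * del (Pi.single j 1) (fun y ↦ (W.φ₂ y : ℂ)) x)

/-- The formal adjoint of a test form is a test function, for `φ₁, φ₂` smooth. [folklore] -/
theorem isTest_formalAdjoint (h₁ : ContMDiff 𝓘(ℝ, ι → ℂ) 𝓘(ℝ, ℝ) ∞ W.φ₁) (h₂ : ContMDiff 𝓘(ℝ, ι → ℂ) 𝓘(ℝ, ℝ) ∞ W.φ₂)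
    {f : ι → D → ℂ} (hf : ∀ j, IsTest (f j)) : IsTest (W.formalAdjoint f) := by
  have hsum : IsTest fun x ↦ ∑ j, (del (Pi.single j 1) (f j) x - f j x * del (Pi.single j 1) (fun y ↦ (W.φ₂ y : ℂ)) x) :=
    IsTest.sum fun j _ ↦ ((hf j).del _).sub' ((hf j).mul_right (contMDiff_del (contMDiff_ofReal h₂) _))
  have hexp : ContMDiff 𝓘(ℝ, ι → ℂ) 𝓘(ℝ, ℂ) ∞ fun x ↦ -(Real.exp (W.φ₁ x - W.φ₂ x) : ℂ) :=
    (contMDiff_ofReal (contMDiff_exp (h₁.sub h₂))).neg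
  exact hsum.mul_left hexp

/-- **The pointwise identity behind (4.2.4)**: `e^{-φ₁} conj(ϑ f) = -∑_j ∂̄_j (f̄_j e^{-φ₂})`.
[cite: HormanderSCV1973, §4.2 (p. 83, (4.2.4))] -/
theorem exp_mul_conj_formalAdjoint (h₂ : ContMDiff 𝓘(ℝ, ι → ℂ) 𝓘(ℝ, ℝ) ∞ W.φ₂) {f : ι → D → ℂ}
    (hf : ∀ j, IsTest (f j)) (x : D) :
    (Real.exp (-W.φ₁ x) : ℂ) * conj (W.formalAdjoint f x) =
      -∑ j, dbar (Pi.single j 1) (fun y ↦ conj (f j y) * (Real.exp (-W.φ₂ y) : ℂ)) x := by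
  have hprod : ∀ j, dbar (Pi.single j 1) (fun y ↦ conj (f j y) * (Real.exp (-W.φ₂ y) : ℂ)) x =
      conj (f j x) * dbar (Pi.single j 1) (fun y ↦ (Real.exp (-W.φ₂ y) : ℂ)) x +
        dbar (Pi.single j 1) (fun y ↦ conj (f j y)) x * (Real.exp (-W.φ₂ x) : ℂ) :=
    fun j ↦ dbar_mul_apply (contMDiff_conj (hf j).contMDiff) (contMDiff_exp_neg h₂) (Pi.single j 1) x
  have hE : (Real.exp (-W.φ₁ x) : ℂ) * (Real.exp (W.φ₁ x - W.φ₂ x) : ℂ) = (Real.exp (-W.φ₂ x) : ℂ) := by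
    rw [← ofReal_mul, ← Real.exp_add]
    congr 1; ring_nf
  have hL : (Real.exp (-W.φ₁ x) : ℂ) * conj (W.formalAdjoint f x) =
      ∑ j, (Real.exp (-W.φ₁ x) : ℂ) * conj (-(Real.exp (W.φ₁ x - W.φ₂ x) : ℂ) *
        (del (Pi.single j 1) (f j) x - f j x * del (Pi.single j 1) (fun y ↦ (W.φ₂ y : ℂ)) x)) := by
    rw [formalAdjoint, Finset.mul_sum, _root_.map_sum, Finset.mul_sum]
  rw [hL, ← Finset.sum_neg_distrib]
  refine Finset.sum_congr rfl fun j _ ↦ ?_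
  rw [hprod, dbar_conj, dbar_exp_neg h₂, dbar_ofReal_eq_conj_del]
  simp only [_root_.map_mul, _root_.map_neg, _root_.map_sub, conj_ofReal]
  linear_combination (-(conj (del (Pi.single j 1) (f j) x)) + conj (f j x) * conj (del (Pi.single j 1) (fun y ↦ (W.φ₂ y : ℂ)) x)) * hE

/-- **The adjoint identity on test forms**: `(ϑ f, u)_{φ₁} = (f, T u)_{φ₂}` for every `u ∈ D_T`
(the weak relation `T u = ∂̄ u` tested against `f̄_j e^{-φ₂}`). [cite: HormanderSCV1973, §4.2 (p. 83)] -/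
theorem inner_formalAdjoint_eq (h₁ : ContMDiff 𝓘(ℝ, ι → ℂ) 𝓘(ℝ, ℝ) ∞ W.φ₁) (h₂ : ContMDiff 𝓘(ℝ, ι → ℂ) 𝓘(ℝ, ℝ) ∞ W.φ₂)
    {f : ι → D → ℂ} (hf : ∀ j, IsTest (f j)) (u : W.T.domain) :
    ⟪W.testFn (isTest_formalAdjoint h₁ h₂ hf), (u : W.H1)⟫_ℂ = ⟪W.testForm hf, W.T u⟫_ℂ := by
  have hT := hasWeakDbar_T u
  have hwj : ∀ j, IsTest fun x ↦ conj (f j x) * (Real.exp (-W.φ₂ x) : ℂ) := fun j ↦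
    (hf j).conj.mul_right (contMDiff_exp_neg h₂)
  have hrel : ∀ j, ∫ x, (W.T u j : D → ℂ) x * (conj (f j x) * (Real.exp (-W.φ₂ x) : ℂ)) ∂D.vol =
      -∫ x, ((u : W.H1) : D → ℂ) x * dbar (Pi.single j 1) (fun y ↦ conj (f j y) * (Real.exp (-W.φ₂ y) : ℂ)) x ∂D.vol :=
    fun j ↦ by
    have := hT.integral_eq j _ (hwj j)
    linear_combination this
  have hiD : ∀ j, Integrable (fun x ↦ ((u : W.H1) : D → ℂ) x *
      dbar (Pi.single j 1) (fun y ↦ conj (f j y) * (Real.exp (-W.φ₂ y) : ℂ)) x) D.vol := fun j ↦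
    integrable_mul_isTest (locallyIntegrable_H1 (u : W.H1)) ((hwj j).dbar _)
  -- right-hand side
  have hR : ⟪W.testForm hf, W.T u⟫_ℂ =
      -∫ x, ∑ j, ((u : W.H1) : D → ℂ) x * dbar (Pi.single j 1) (fun y ↦ conj (f j y) * (Real.exp (-W.φ₂ y) : ℂ)) x ∂D.vol := by
    rw [inner_H2, integral_finsetSum _ fun j _ ↦ hiD j, ← Finset.sum_neg_distrib]
    refine Finset.sum_congr rfl fun j _ ↦ ?_
    rw [← hrel j]
    refine integral_congr_ae ?_
    filter_upwards [coeFn_testForm (W := W) hf j] with x hx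
    rw [hx]; ring
  -- left-hand side
  have hL : ⟪W.testFn (isTest_formalAdjoint h₁ h₂ hf), (u : W.H1)⟫_ℂ =
      ∫ x, ((u : W.H1) : D → ℂ) x * ((Real.exp (-W.φ₁ x) : ℂ) * conj (W.formalAdjoint f x)) ∂D.vol := by
    rw [inner_H1]
    refine integral_congr_ae ?_
    filter_upwards [coeFn_testFn (W := W) (isTest_formalAdjoint h₁ h₂ hf)] with x hx
    rw [hx]; ring
  rw [hR, hL, ← integral_neg]
  refine integral_congr_ae (ae_of_all _ fun x ↦ ?_)
  dsimp only
  rw [exp_mul_conj_formalAdjoint h₂ hf x, mul_neg, Finset.mul_sum]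

set_option maxHeartbeats 800000 in
/-- **Test forms lie in `D_{T*}` and `T* f = ϑ f`** (Hörmander p. 83: «if `f ∈ D_{(0,1)}(Ω)` we
obtain [(4.2.4)] by using the fact that [`∂/∂z̄_k` and `-δ_k` are adjoint on `C₀^∞`]»), for smooth
weights `φ₁, φ₂`. [cite: HormanderSCV1973, §4.2 (p. 83, (4.2.4))] -/
theorem adjoint_testForm (h₁ : ContMDiff 𝓘(ℝ, ι → ℂ) 𝓘(ℝ, ℝ) ∞ W.φ₁) (h₂ : ContMDiff 𝓘(ℝ, ι → ℂ) 𝓘(ℝ, ℝ) ∞ W.φ₂)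
    {f : ι → D → ℂ} (hf : ∀ j, IsTest (f j)) :
    ∃ hmem : W.testForm hf ∈ W.T†.domain,
      W.T† ⟨W.testForm hf, hmem⟩ = W.testFn (isTest_formalAdjoint h₁ h₂ hf) := by
  have key : ∀ u : W.T.domain, ⟪W.testFn (isTest_formalAdjoint h₁ h₂ hf), (u : W.H1)⟫_ℂ = ⟪W.testForm hf, W.T u⟫_ℂ :=
    fun u ↦ inner_formalAdjoint_eq h₁ h₂ hf u
  have hmem : W.testForm hf ∈ W.T†.domain :=
    LinearPMap.mem_adjoint_domain_of_exists (T := W.T) (W.testForm hf)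
      ⟨W.testFn (isTest_formalAdjoint h₁ h₂ hf), key⟩
  exact ⟨hmem, LinearPMap.adjoint_apply_eq (T := W.T) (dense_domT (W := W)) ⟨W.testForm hf, hmem⟩ key⟩

/-- Test forms lie in `D_{T*}` (smooth weights). [cite: HormanderSCV1973, §4.2 (p. 83)] -/
theorem testForm_mem_adjoint (h₁ : ContMDiff 𝓘(ℝ, ι → ℂ) 𝓘(ℝ, ℝ) ∞ W.φ₁) (h₂ : ContMDiff 𝓘(ℝ, ι → ℂ) 𝓘(ℝ, ℝ) ∞ W.φ₂)
    {f : ι → D → ℂ} (hf : ∀ j, IsTest (f j)) : W.testForm hf ∈ W.T†.domain :=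
  (adjoint_testForm h₁ h₂ hf).1

/-- The pairing of `T* f` with a test function, as an integral. [folklore] -/
theorem inner_adjoint_testFn (f : W.T†.domain) {u : D → ℂ} (hu : IsTest u) :
    ⟪W.T† f, W.testFn hu⟫_ℂ = ∫ x, (Real.exp (-W.φ₁ x) : ℂ) * (conj ((W.T† f : D → ℂ) x) * u x) ∂D.vol := by
  rw [inner_H1]
  refine integral_congr_ae ?_
  filter_upwards [coeFn_testFn (W := W) hu] with x hx
  rw [hx]

/-- The pairing of `f ∈ H₂` with `T` of a test function, as a sum of integrals. [folklore] -/
theorem inner_T_testFn (f : W.H2) {u : D → ℂ} (hu : IsTest u) :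
    ⟪f, W.T ⟨W.testFn hu, testFn_mem_domT hu⟩⟫_ℂ =
      ∑ j, ∫ x, (Real.exp (-W.φ₂ x) : ℂ) * (conj ((f j : D → ℂ) x) * dbar (Pi.single j 1) u x) ∂D.vol := by
  obtain ⟨hmem, hTu⟩ := T_testFn (W := W) hu
  rw [hTu, inner_H2]
  refine Finset.sum_congr rfl fun j _ ↦ integral_congr_ae ?_
  filter_upwards [coeFn_testForm (W := W) (fun j ↦ hu.dbar (Pi.single j 1)) j] with x hx
  rw [hx]

/-- **The adjoint identity tested against a test function**, conjugated into the bilinear form used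
by the weak divergence relation: for `f ∈ D_{T*}` and a test function `w`,
`∑_j ∫ f_j e^{-φ₂} ∂_j w d vol = ∫ (T* f) e^{-φ₁} w d vol`. [cite: HormanderSCV1973, §4.2 (p. 83)] -/
theorem sum_integral_adjoint_eq (f : W.T†.domain) {w : D → ℂ} (hw : IsTest w) :
    ∑ j, ∫ x, ((f : W.H2) j : D → ℂ) x * (Real.exp (-W.φ₂ x) : ℂ) * del (Pi.single j 1) w x ∂D.vol =
      ∫ x, (W.T† f : D → ℂ) x * (Real.exp (-W.φ₁ x) : ℂ) * w x ∂D.vol := by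
  have hu : IsTest fun x ↦ conj (w x) := hw.conj
  have hadj : ⟪W.T† f, W.testFn hu⟫_ℂ = ⟪(f : W.H2), W.T ⟨W.testFn hu, testFn_mem_domT hu⟩⟫_ℂ :=
    LinearPMap.adjoint_isFormalAdjoint (T := W.T) (dense_domT (W := W)) f ⟨W.testFn hu, testFn_mem_domT hu⟩
  rw [inner_adjoint_testFn f hu, inner_T_testFn (f : W.H2) hu] at hadj
  -- conjugate both sides
  have hL : conj (∫ x, (Real.exp (-W.φ₁ x) : ℂ) * (conj ((W.T† f : D → ℂ) x) * conj (w x)) ∂D.vol) =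
      ∫ x, (W.T† f : D → ℂ) x * (Real.exp (-W.φ₁ x) : ℂ) * w x ∂D.vol := by
    rw [← integral_conj]
    refine integral_congr_ae (ae_of_all _ fun x ↦ ?_)
    simp only [_root_.map_mul, conj_conj, conj_ofReal]
    ring
  have hR : ∀ j, conj (∫ x, (Real.exp (-W.φ₂ x) : ℂ) * (conj (((f : W.H2) j : D → ℂ) x) *
      dbar (Pi.single j 1) (fun y ↦ conj (w y)) x) ∂D.vol) =
      ∫ x, ((f : W.H2) j : D → ℂ) x * (Real.exp (-W.φ₂ x) : ℂ) * del (Pi.single j 1) w x ∂D.vol := by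
    intro j
    rw [← integral_conj]
    refine integral_congr_ae (ae_of_all _ fun x ↦ ?_)
    have hcd : conj (dbar (Pi.single j 1) (fun y ↦ conj (w y)) x) = del (Pi.single j 1) w x := by
      rw [dbar_conj, conj_conj]
    simp only [_root_.map_mul, conj_conj, conj_ofReal, hcd]
    ring
  have := congrArg conj hadj
  rw [hL, _root_.map_sum] at this
  simp_rw [hR] at this
  exact this.symm

/-- **The distributional identity of `D_{T*}`**: for every `f ∈ D_{T*}`,
`∑_j ∂_j (e^{-φ₂} f_j) = -e^{-φ₁} T* f` weakly (test the adjoint identity `(T* f, u) = (f, T u)`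
against test functions `u`). This is the form in which `T*` enters Friedrichs' lemma in the proof
of the density Lemma 4.1.3 / (4.1.9). [cite: HormanderSCV1973, §4.1 (p. 80, (4.1.9)), §4.2 (p. 83)] -/
theorem hasWeakDelDiv_adjoint (f : W.T†.domain) :
    HasWeakDelDiv D (fun x j ↦ ((f : W.H2) j : D → ℂ) x * (Real.exp (-W.φ₂ x) : ℂ))
      (fun x ↦ -(W.T† f : D → ℂ) x * (Real.exp (-W.φ₁ x) : ℂ)) where
  locallyIntegrable j := locallyIntegrable_mul_continuous (locallyIntegrable_H2 (f : W.H2) j)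
    (continuous_ofReal.comp (Real.continuous_exp.comp W.continuous₂.neg))
  locallyIntegrable_div := locallyIntegrable_mul_continuous (locallyIntegrable_H1 (W.T† f)).neg
    (continuous_ofReal.comp (Real.continuous_exp.comp W.continuous₁.neg))
  integral_eq w hw := by
    have hi : ∀ j, Integrable (fun x ↦ ((f : W.H2) j : D → ℂ) x * (Real.exp (-W.φ₂ x) : ℂ) * del (Pi.single j 1) w x) D.vol :=
      fun j ↦ integrable_mul_isTest (locallyIntegrable_mul_continuous (locallyIntegrable_H2 (f : W.H2) j)
        (continuous_ofReal.comp (Real.continuous_exp.comp W.continuous₂.neg))) (hw.del _)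
    rw [integral_finsetSum _ fun j _ ↦ hi j, sum_integral_adjoint_eq f hw, ← integral_neg]
    refine integral_congr_ae (ae_of_all _ fun x ↦ ?_)
    ring

end Adjoint

end Weights

end RiemannDomain

end Literature.Analysis.Complex
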